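import Mathlib
import HarnessLib
import Summits.QuantumFields.BalabanUV.Beta.GaugeFixingPotential254
import Literature.MathematicalPhysics.QuantumFieldTheory.Balaban1983to89.B7TransferAnalyticMean

/-!
# [Balaban1987RG1] p. 253 (0.5)–(0.9), (0.11) and p. 266 (2.5): the BLOCK VARIABLES `X_{yx}(B′) = (1/i) log Ṽ′(y,x)(B′)` of the
# gauge-fixing term from the AXIOMS OF THE ABSTRACT AVERAGE — analytic near `B′ = 0`, vanishing there, bounded by `2K`, with
# `e^{iX_{yx}(B′)} = Ṽ′(y,x)(B′)`; the `Chart` of `GaugeFixingCubic266` for the printed potential DISCHARGED down to the contour-variable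
# maps (cell topic `Summits/QuantumFields/BalabanUV/Beta/GaugeFixingBlockVariable253`; third module of the (2.5) group, same unit)

HONEST FRAMING (cell rule).  Discharging `BetaPertH` makes Bałaban's UV stability UNCONDITIONAL — a real constructive-QFT result; NOT the
continuum limit, NOT the Clay problem.  This module discharges NOTHING of `BetaPertH`.  It removes the last analytic DICTIONARY item of the
`G₃`-clause of [I] (2.5) (cell GAPS G-adv9-20 column (a), terminal leaf (T4)(a) of row D4; `GaugeFixingCubic266` p202436 abstract, `GaugeFixing
Potential254` p202927 the printed potential): there the block variables `X_i` were HYPOTHESES («analytic on a ball, bounded by MX, X_i(0) = 0»);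
here they are CONSTRUCTED from [I]'s own abstract-average axioms as typed in the tree (`B7TransferAnalyticMean.IsAnalyticMean`, b07) and the
matrix logarithm (`MatrixLog.mlog`), leaving as hypotheses only the CONTOUR-VARIABLE MAPS `B′ ↦ {(V′V^{(k)})(Γ)·V^{(k)}(y,x)⁻¹}_Γ` (analytic —
products of exponentials —, `r`-close to the identity tuple — small-field regularity —, average `= 1` at `B′ = 0` — axiom (0.6) + the definition
(0.11) of the averaged variable).  Bookkeeping-grade [folklore]; NOT summit progress.  Unit `b2b-balaban-beta-an4-g32` (row D4 owner).

CITATION HEADER (lean-in-tree rule).  [I] = T. Bałaban, Commun. Math. Phys. **109**, 249–301 (1987) [Balaban1987RG1] (PDF page = journal page −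
248), renders `HOME/b2b-balaban-ref1/pages/1987-cmp109-rg-I-small-field/…-p005-x2.png` (p. 253), `…-p006-x2.png` (p. 254), `…-p018-x2.png` (p. 266) READ
AS IMAGES by this seat.  p. 253 (verbatim, as in `B7TransferAnalyticMean`'s header): *«We denote it by {U_j}‾ = M({U_j}), and we assume that it is an
analytic function having the following properties: M({U_j⁻¹}) = M({U_j})⁻¹; (0.5)  M({uU_jv}) = uM({U_j})v; (0.6) … for a set {U_j} of elements close
to the identity of the group, i.e. U_j = exp iA_j with A_j in a small neighborhood of 0 in 𝔤ᶜ, the average is close to the identity also, and (1/i) log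
M({exp iA_j}) = (1/n) Σ_{j=1}^{n} A_j + (higher order terms); (0.8)»*; p. 253 (0.11): *«U(y,x) = M({U(Γ)}_{Γ∈G(y,x)}). (0.11)»*; p. 266: *«The variables
Ṽ′(y,x) = (V′V^{(k)})(y,x)(V^{(k)}(y,x))⁻¹ have an expansion of the form Ṽ′(y,x) = 1 + B̃′(y,x) + …, where B̃′(y,x) is a linear function»* and (2.5).

THE READING (DERIVED; hypotheses named).  Fix a pair `i = (y,x)` with contour set `C` (print's `G(y,x)`), the background's averaged variable
`W := V^{(k)}(y,x) = M({V^{(k)}(Γ)}_Γ)` ((0.11)), and the REDUCED contour tuple `T(B′) := {(V′V^{(k)})(Γ)·W⁻¹}_Γ` where `V′ = e^{iB′}`.  By (0.6) with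
`u = 1`, `v = W⁻¹`: `(V′V^{(k)})(y,x)·W⁻¹ = M(T(B′))`, i.e. `Ṽ′(y,x)(B′) = M(T(B′))`, and at `B′ = 0`: `M(T(0)) = M({V^{(k)}(Γ)})·W⁻¹ = 1`.  So
`X_{yx}(B′) := (1/i)·log M(T(B′))` — this file's `blockVar M T B := (−i)·mlog (M (T B))`.  HYPOTHESES kept: `IsAnalyticMean M r K` (the tree's typed form of
p. 253: `M` analytic on the polydisc `ball 1 r` of tuples, `‖M U − 1‖ ≤ K ≤ ½` there, `M 1 = 1`, `DM(1) =` arithmetic mean), `T` analytic on `ball 0 ρ` and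
mapping it into `ball 1 r` (products of exponentials of `B′` times a background tuple whose members are `r`-close to their average — SMALL FIELD), and
`M (T 0) = 1` (the (0.6)-normalisation above).

WHAT THIS FILE PROVES ([folklore]): §1 `blockVar`, `blockVar_zero` (`X(0) = 0`), `analyticOnNhd_blockVar` (analytic on `ball 0 ρ`), `norm_blockVar_le`
(`‖X(B′)‖ ≤ 2K`), **`exp_I_smul_blockVar`** (`e^{iX(B′)} = M(T(B′))` = `Ṽ′(y,x)(B′)` — the chart is the right one), **`gfPot_blockVar`** (the printed
summand: `gfPot τ (X(B′)) = τ1 − ½τ(Ṽ′ + Ṽ′⁻¹)` = «1 − Re tr Ṽ′(y,x)» with `Ṽ′ = M(T B′)`); §2 **`chart_blockVar`** — the hypothesis bundle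
`GaugeFixingCubic266.Chart (gfPot τ) (fun i => blockVar (M i) (T i)) Rφ (‖τ‖(1 + e^{Rφ})) ρ (2K)` HOLDS for any family of pairs with dependent contour
types `C i`, and **`gaugeFixing_cubic_blockVar`** — every conclusion of (2.5) (G₃ analytic, `BeginsAt G₃ 3`, the cubic bound, `G₃ = rem G 2`, the
quadratic form `ΣΣ ½τ(B̃′²)`) for `G(B′) := Σ_{(y,x)} [τ1 − ½τ(Ṽ′(y,x) + Ṽ′(y,x)⁻¹)]` built from the averages.
NOT CLAIMED: the contour-variable maps themselves (products of exponentials along the contours of `G(y,x)` on the corner-cube geometry — b12's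
`B12ContourAverage253`∕`BlockAveragingFederbush` objects are not imported), their `r`-closeness to the identity tuple on a k-∕VOLUME-UNIFORM ball of
`B′` (small-field regularity, [I] (0.16)∕(1.19)), the (0.6)-reduction as an identity of Bałaban's concrete average (hypothesis `M (T 0) = 1` here), and the
conventions (τ1 = 1, Hermitian 𝔤).  No `def … : Prop`; nothing about Bałaban's `β`-functions is asserted.
PRIOR ART IN THE TREE (searched 2026-08-20; nothing re-derived): `B7TransferAnalyticMean` (`IsAnalyticMean`, `analyticOnNhd_mlog_comp`, `norm_mlog_comp_le`),
`MatrixLog` (`mlog`, `mlog_one`, `exp_mlog`), `GaugeFixingPotential254` (`gfPot`, `chart_gfPot`, `expUnit`), `GaugeFixingCubic266` (`Chart` and its theorems) —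
all BY NAME; `B12ContourAverage253` (b12-g23: the concrete averaged contour variables and their small diameter — the natural supplier of this file's
`T`-hypotheses, not imported here).
-/

open Metric Set Filter Topology
open Complex (I)
open NormedSpace (exp)
open Literature.MathematicalPhysics.QuantumFieldTheory.Balaban1983to89
open B7TransferAnalyticMean (IsAnalyticMean)
open MatrixLog (mlog mlog_one exp_mlog)
open B13ExpansionOrder (BeginsAt homPart rem)
open Summit.QuantumFields.BalabanUV.Beta.GaugeFixingCubic266
open Summit.QuantumFields.BalabanUV.Beta.GaugeFixingPotential254

namespace Summit.QuantumFields.BalabanUV.Beta.GaugeFixingBlockVariable253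

noncomputable section

variable {𝔄 : Type*} [NormedRing 𝔄] [NormedAlgebra ℂ 𝔄] [CompleteSpace 𝔄]
variable {E : Type*} [NormedAddCommGroup E] [NormedSpace ℂ E]
variable {C : Type*} [Fintype C]

/-! ## §1. One pair `(y,x)`: the block variable from the average of the reduced contour tuple -/

/-- The block variable `X_{yx}(B′) = (1/i) log Ṽ′(y,x)(B′)` with `Ṽ′(y,x)(B′) = M(T(B′))` (the (0.6)-reduced form of
`(V′V^{(k)})(y,x)(V^{(k)}(y,x))⁻¹`): `(−i)·mlog (M (T B))`. [cite: Balaban1987RG1, p.266] -/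
def blockVar (M : (C → 𝔄) → 𝔄) (T : E → C → 𝔄) (B : E) : 𝔄 := (-I) • mlog (M (T B))

variable {M : (C → 𝔄) → 𝔄} {r K : ℝ} {T : E → C → 𝔄} {ρ : ℝ}

omit [CompleteSpace 𝔄] [Fintype C] [NormedSpace ℂ E] in
/-- `X_{yx}(0) = 0`: at `B′ = 0` the reduced tuple averages to `1` ((0.6) + (0.11)), and `log 1 = 0`. [folklore] -/
theorem blockVar_zero (h0 : M (T 0) = 1) : blockVar M T 0 = 0 := by
  rw [blockVar, h0, mlog_one, smul_zero]

omit [CompleteSpace 𝔄] [NormedSpace ℂ E] in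
/-- On the `B′`-ball the average is within `K ≤ ½` of `1`. [folklore] -/
theorem norm_avg_sub_one_le (hM : IsAnalyticMean M r K) (hmaps : MapsTo T (ball (0 : E) ρ) (ball (1 : C → 𝔄) r)) {B : E}
    (hB : B ∈ ball (0 : E) ρ) : ‖M (T B) - 1‖ ≤ K :=
  hM.norm_sub_one_le _ (hmaps hB)

/-- **Analyticity of the block variable** on `ball 0 ρ`: `T` analytic into the polydisc where `M` is analytic and `½`-close to `1`, then `mlog`.
[cite: Balaban1987RG1, (2.5) p.266] -/
theorem analyticOnNhd_blockVar (hM : IsAnalyticMean M r K) (hT : AnalyticOnNhd ℂ T (ball (0 : E) ρ))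
    (hmaps : MapsTo T (ball (0 : E) ρ) (ball (1 : C → 𝔄) r)) : AnalyticOnNhd ℂ (blockVar M T) (ball (0 : E) ρ) := by
  have hdef : blockVar M T = (-I : ℂ) • fun B : E => mlog (M (T B)) := rfl
  rw [hdef]
  intro B hB
  have h1 : AnalyticAt ℂ (fun B : E => mlog (M (T B))) B :=
    (hM.analyticOnNhd_mlog_comp (T B) (hmaps hB)).comp_of_eq (hT B hB) rfl
  exact h1.const_smul

omit [NormedSpace ℂ E] in
/-- **The sup bound** `‖X_{yx}(B′)‖ ≤ 2K` on the ball (`‖log U‖ ≤ 2‖U − 1‖` for `‖U − 1‖ ≤ ½`). [folklore] -/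
theorem norm_blockVar_le (hM : IsAnalyticMean M r K) (hmaps : MapsTo T (ball (0 : E) ρ) (ball (1 : C → 𝔄) r)) {B : E}
    (hB : B ∈ ball (0 : E) ρ) : ‖blockVar M T B‖ ≤ 2 * K := by
  rw [blockVar, norm_smul, norm_neg, Complex.norm_I, one_mul]
  exact hM.norm_mlog_comp_le _ (hmaps hB)

omit [NormedSpace ℂ E] in
/-- **The chart is the right one**: `e^{iX_{yx}(B′)} = M(T(B′)) = Ṽ′(y,x)(B′)`. [cite: Balaban1987RG1, p.266] -/
theorem exp_I_smul_blockVar (hM : IsAnalyticMean M r K) (hmaps : MapsTo T (ball (0 : E) ρ) (ball (1 : C → 𝔄) r)) {B : E}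
    (hB : B ∈ ball (0 : E) ρ) : exp (I • blockVar M T B) = M (T B) := by
  have hlt : ‖M (T B) - 1‖ < 1 := (norm_avg_sub_one_le hM hmaps hB).trans_lt (by linarith [hM.K_le_half])
  rw [blockVar, smul_smul, mul_neg, Complex.I_mul_I, neg_neg, one_smul, exp_mlog hlt]

omit [NormedSpace ℂ E] in
/-- **The printed gauge-fixing summand at `(y,x)` IS the potential at the block variable**: `gfPot τ (X_{yx}(B′)) = τ1 − ½τ(Ṽ′ + Ṽ′⁻¹)` with
`Ṽ′ = M(T(B′))` — «1 − Re tr Ṽ′(y,x)» in the G^c reading, cf. `GaugeFixingPotential254.gfPot_eq_wil`. [cite: Balaban1987RG1, (0.19) p.255] -/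
theorem gfPot_blockVar (τ : 𝔄 →L[ℂ] ℂ) (hM : IsAnalyticMean M r K) (hmaps : MapsTo T (ball (0 : E) ρ) (ball (1 : C → 𝔄) r)) {B : E}
    (hB : B ∈ ball (0 : E) ρ) :
    gfPot τ (blockVar M T B) = τ 1 - (2 : ℂ)⁻¹ * τ (M (T B) + ((expUnit (I • blockVar M T B))⁻¹ : 𝔄ˣ)) ∧
      ((expUnit (I • blockVar M T B) : 𝔄ˣ) : 𝔄) = M (T B) := by
  refine ⟨?_, by rw [coe_expUnit, exp_I_smul_blockVar hM hmaps hB]⟩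
  rw [gfPot, coe_expUnit_inv, exp_I_smul_blockVar hM hmaps hB]

/-! ## §2. All pairs: the `Chart` of the (2.5) modules DISCHARGED down to the contour-variable maps -/

variable {ι : Type*} {Cf : ι → Type*} [∀ i, Fintype (Cf i)]

omit [CompleteSpace 𝔄] in
/-- `0 ≤ K` for any abstract average (evaluate the bound at the identity tuple). [folklore] -/
theorem K_nonneg (hM : IsAnalyticMean M r K) : 0 ≤ K :=
  (norm_nonneg _).trans (hM.norm_sub_one_le 1 (mem_ball_self hM.r_pos))

/-- **The hypothesis bundle of `GaugeFixingCubic266` for the PRINTED potential and the CONSTRUCTED block variables**: for a family of pairs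
`i` with contour types `Cf i`, averages `Mf i` satisfying [I] p. 253's axioms (`IsAnalyticMean (Mf i) r K`), contour-variable maps `Tf i` analytic on
`ball 0 ρ` into the polydisc `ball 1 r` with `Mf i (Tf i 0) = 1`, and any `Rφ > 2K`:
`Chart (gfPot τ) (fun i => blockVar (Mf i) (Tf i)) Rφ (‖τ‖(1 + e^{Rφ})) ρ (2K)`. [cite: Balaban1987RG1, (2.5) p.266] -/
theorem chart_blockVar [NormOneClass 𝔄] (τ : 𝔄 →L[ℂ] ℂ) {Mf : ∀ i, (Cf i → 𝔄) → 𝔄} {Tf : ∀ i, E → Cf i → 𝔄} {Rφ : ℝ}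
    (hM : ∀ i, IsAnalyticMean (Mf i) r K) (hT : ∀ i, AnalyticOnNhd ℂ (Tf i) (ball (0 : E) ρ))
    (hmaps : ∀ i, MapsTo (Tf i) (ball (0 : E) ρ) (ball (1 : Cf i → 𝔄) r)) (h0 : ∀ i, Mf i (Tf i 0) = 1) (hK : 0 ≤ K) (hρ : 0 < ρ)
    (hRφ : 2 * K < Rφ) :
    Chart (gfPot τ) (fun i => blockVar (Mf i) (Tf i)) Rφ (‖τ‖ * (1 + Real.exp Rφ)) ρ (2 * K) :=
  chart_gfPot τ (by linarith) hρ (fun i => analyticOnNhd_blockVar (hM i) (hT i) (hmaps i))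
    (fun i B hB => norm_blockVar_le (hM i) (hmaps i) hB) (fun i => blockVar_zero (h0 i)) hRφ

/-- **(2.5) from the axioms of the average**: with `G(B′) := Σ_{(y,x)} gfPot τ (X_{yx}(B′))` (= `ΣΣ [τ1 − ½τ(Ṽ′(y,x) + Ṽ′(y,x)⁻¹)]` by `gfPot_blockVar`),
`G₃ := G − ΣΣ ½τ(B̃′(y,x)²)` is analytic on `ball 0 ρ`, begins with third order terms, obeys the explicit cubic bound, and is `rem G 2` — the
conclusions of `GaugeFixingCubic266` with EVERY hypothesis on `φ` and on the `X_i` discharged, down to the contour-variable maps `Tf i`.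
[cite: Balaban1987RG1, (2.5) p.266] -/
theorem gaugeFixing_cubic_blockVar [NormOneClass 𝔄] [Fintype ι] (τ : 𝔄 →L[ℂ] ℂ) {Mf : ∀ i, (Cf i → 𝔄) → 𝔄}
    {Tf : ∀ i, E → Cf i → 𝔄} {Rφ : ℝ} (hM : ∀ i, IsAnalyticMean (Mf i) r K) (hT : ∀ i, AnalyticOnNhd ℂ (Tf i) (ball (0 : E) ρ))
    (hmaps : ∀ i, MapsTo (Tf i) (ball (0 : E) ρ) (ball (1 : Cf i → 𝔄) r)) (h0 : ∀ i, Mf i (Tf i 0) = 1) (hK : 0 ≤ K) (hρ : 0 < ρ)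
    (hRφ : 2 * K < Rφ) :
    AnalyticOnNhd ℂ (gCubic (gfPot τ) (fun i => blockVar (Mf i) (Tf i))) (ball 0 ρ) ∧
      BeginsAt (gCubic (gfPot τ) (fun i => blockVar (Mf i) (Tf i))) 3 ∧
      (∀ B ∈ ball (0 : E) ρ, ‖gCubic (gfPot τ) (fun i => blockVar (Mf i) (Tf i)) B‖ ≤
        cubicConst Rφ (‖τ‖ * (1 + Real.exp Rφ)) ρ (2 * K) (Fintype.card ι) * ‖B‖ ^ 3) ∧
      gCubic (gfPot τ) (fun i => blockVar (Mf i) (Tf i)) = rem (gTot (gfPot τ) (fun i => blockVar (Mf i) (Tf i))) 2 := by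
  have h := chart_blockVar τ hM hT hmaps h0 hK hρ hRφ
  exact ⟨h.analyticOnNhd_gCubic, h.beginsAt_gCubic_three, fun B hB => h.norm_gCubic_le hB, h.gCubic_eq_rem⟩

end

end Summit.QuantumFields.BalabanUV.Beta.GaugeFixingBlockVariable253
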